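import Summits.BirchSwinnertonDyer.BirchSwinnertonDyer.Theorems.KatoDescentTamePotSupersingularTameUpperMuRoadFiveRecordsSplit03
import Summits.BirchSwinnertonDyer.BirchSwinnertonDyer.Theorems.KatoDescentTamePotSupersingularCartanMuRoadSplitFiveIndexTwoAbelDoors
import HarnessLib

/-!
# Route `KatoDescentTamePotSupersingular` (rung K8, sub-rung B4 (t′), cell `bsd-potss`): per-row (A) and U₀ RE-RECORD of the index-2 `5Ns` row 446400hu1
# (image `G₁₆ ≅ M₁₆`) WITHOUT Ferrero–Washington and WITHOUT Coates–Sujatha as named facts (seat `bsd-potss-k8t-c4` g24; door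
# `CartanMuRoadSplitFiveIndexTwoAbelDoors.{conjA_five,missingUpperBoundAt_five_tame}_of_splitCartanIndexTwoBasis_of_classData`; `--supports 19982 --as helper`)

HONEST FRAMING. THEOREMS ONLY (no definition, no named fact, no `sorry`); PER ROW — NOT a class theorem; nothing is booked; items 19916 / 19202 / 19982 stay
OPEN at class level (class-wide open inputs: the zeta crux 24439 and the lower half of the residual 19984); (A), Conjecture A and BSD are proved for NO curve
here. This is k8t-c4 g18's record `…FiveRecordsSplit03` (kernel lemmas REUSED from there) with the two named facts of the (A)-input GONE: `hCS` is the tree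
theorem `thm34_…_holds` (g22) and `hFW` is REPLACED — by `Literature/…/ClassicalMuVanishesSplitCartanFiveIndexTwoAbelian` (g24: on `G₁₆ = ⟨a, s⟩ ≅ M₁₆` the
four linear characters invisible in `ℚ(P₁)` live on the cyclic quartic `K″ = L^⟨a⁴,s⟩`, on `Z = L^⟨a²s⟩ = L^{ker det} = ℚ(ζ₅)` and on the two quadratic
fields `L^⟨a⟩`, `L^⟨a²,as⟩` outside `ℚ(P₁)`) — by DISPLAYED class data: five Iwasawa-1956 certificates «`5 ∤ h`, one prime above 5» (PROVED). NUMERICS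
(evidence, not kernel; kit j328433 / j328436, the g24 engine with an `M₁₆` branch enumerating all 16 admissible pairs `(a, s)` with `ord a = 8`, `s` a
non-central involution, `a s a⁻¹ = a⁴s`, `L^<s> ≅ ℚ(P₁)`; fixed fields by `galoisfixedfield`, class numbers CERTIFIED): for every pair `K″ = x^4 - 10x^2 - 15x - 5`
(cyclic C(4)) h = 1, primes above 5 [[4,1]]; `Z = x^4 - x^3 + x^2 - x + 1 ≅ ℚ(ζ₅)` h = 1, [[4,1]]; {`L^⟨a⟩`, `L^⟨a²,as⟩`} = {`ℚ(√−3)` (h = 1, [[1,2]]), `ℚ(√−15)` (h = 2, [[2,1]])} — which is which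
depends on the class of `a` among the order-8 elements (8 pairs each way), both leaves certified either way; `ℚ(P₁) = x^8 - 120x^4 - 360x^2 + 720` h = 2, [[8,1]]; `A′ = L^⟨a⁴⟩ = ℚ(ζ₁₅)`, `B′ = L^⟨a²⟩ = ℚ(√5, √−3)` — every leaf PASS:IW56.
So at this row (A) at (E,5) rests on displayed integers and NO named fact; U₀ on `hKatoA hGZK hmod` only.

References: [Kato2004Asterisque] Thm. 12.5 (3), 14.5 (3); [CoatesSujatha2005] Thm. 3.4; [Greenberg2001IwasawaPastPresent] Prop. (2.1); [Washington1997] §13.1;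
[Serre1972] §2.2; [Cremona2006] Table 1.
-/

set_option autoImplicit false
set_option linter.dupNamespace false

noncomputable section

open scoped Classical NumberField Matrix
open WeierstrassCurve Field IntermediateField
  Literature.NumberTheory.EllipticCurves Literature.NumberTheory.EllipticCurves.Rank1Residual
  Literature.NumberTheory.EllipticCurves.Rank1Residual.Typed
  Literature.NumberTheory.GaloisRepresentations Literature.NumberTheory.SerreUniformity
  Literature.NumberTheory.IwasawaTheory
  Summit.BirchSwinnertonDyer.Rank1Residual Summit.BirchSwinnertonDyer.Rank1Residual.Additive
  Summit.BirchSwinnertonDyer.BirchSwinnertonDyer.Theorems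

namespace Summit.BirchSwinnertonDyer.BirchSwinnertonDyer.Theorems.TameConjAFiveRecords

/-- **(A) at `(446400hu1, 5)` with NO named fact**: for every cyclotomic `ℤ_5`-extension `κ` of `ℚ`, the dual fine Selmer group of `E` over `ℚ_cyc` is finitely
generated over `ℤ_5`, from the DISPLAYED `G₁₆`-basis data (`e`, `he`, `σ_s ↦ diag(1,4)`, `σ_a ↦ (0 1;2 0)`) and the DISPLAYED class data of the five leaves
(Iwasawa-1956 certificates); door `CartanMuRoadSplitFiveIndexTwoAbelDoors.conjA_five_of_splitCartanIndexTwoBasis_of_classData` (Coates–Sujatha 3.4 and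
Iwasawa 1956 PROVED; Ferrero–Washington not used). CONDITIONAL record; (A) is asserted for no curve; nothing booked. [cite: CoatesSujatha2005, Thm. 3.4 (§3)]
[cite: Greenberg2001IwasawaPastPresent, Prop. (2.1) (p. 339)] [cite: Serre1972, §2.2] [cite: Cremona2006, Table 1 (Cremona label 446400hu1)] -/
theorem conjA_g446400hu1_5_abel
    {W : WeierstrassCurve ℚ} [W.IsElliptic] (hWeq : W = (⟨0, 0, 0, (-2565000), 1570826250⟩ : WeierstrassCurve ℚ))
    (e : W.geomTorsion (5 : ℕ) ≃+ (Fin 2 → ZMod 5))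
    (he : ∀ σ : absoluteGaloisGroup ℚ, ∃ M ∈ splitCartanNormalizer 5, (M 1 1 = M 0 0 ∨ M 1 1 = 4 * M 0 0) ∧
      (M 1 0 = 2 * M 0 1 ∨ M 1 0 = 3 * M 0 1) ∧ ∀ P : W.geomTorsion (5 : ℕ), e (σ • P) = M *ᵥ e P)
    (σs σa : absoluteGaloisGroup ℚ) (hσs : ∀ P : W.geomTorsion (5 : ℕ), e (σs • P) = !![1, 0; 0, 4] *ᵥ e P)
    (hσa : ∀ P : W.geomTorsion (5 : ℕ), e (σa • P) = !![0, 1; 2, 0] *ᵥ e P)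
    (hhP : haveI : NumberField ↥(W.divisionField 5) := NumberField.mk
      ¬ 5 ∣ NumberField.classNumber ↥(fixedField (Subgroup.zpowers (absRestrictNormalHom (W.divisionField 5) σs))))
    (hvP : haveI : NumberField ↥(W.divisionField 5) := NumberField.mk
      ∃! v : IsDedekindDomain.HeightOneSpectrum (𝓞 ↥(fixedField (Subgroup.zpowers (absRestrictNormalHom (W.divisionField 5) σs)))),
        ((5 : ℕ) : 𝓞 ↥(fixedField (Subgroup.zpowers (absRestrictNormalHom (W.divisionField 5) σs)))) ∈ v.asIdeal)
    (hhK : haveI : NumberField ↥(W.divisionField 5) := NumberField.mk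
      ¬ 5 ∣ NumberField.classNumber ↥(fixedField (Subgroup.zpowers (absRestrictNormalHom (W.divisionField 5) σa * absRestrictNormalHom (W.divisionField 5) σa *
        (absRestrictNormalHom (W.divisionField 5) σa * absRestrictNormalHom (W.divisionField 5) σa)) ⊔ Subgroup.zpowers (absRestrictNormalHom (W.divisionField 5) σs))))
    (hvK : haveI : NumberField ↥(W.divisionField 5) := NumberField.mk
      ∃! v : IsDedekindDomain.HeightOneSpectrum (𝓞 ↥(fixedField (Subgroup.zpowers (absRestrictNormalHom (W.divisionField 5) σa * absRestrictNormalHom (W.divisionField 5) σa *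
        (absRestrictNormalHom (W.divisionField 5) σa * absRestrictNormalHom (W.divisionField 5) σa)) ⊔ Subgroup.zpowers (absRestrictNormalHom (W.divisionField 5) σs)))),
        ((5 : ℕ) : 𝓞 ↥(fixedField (Subgroup.zpowers (absRestrictNormalHom (W.divisionField 5) σa * absRestrictNormalHom (W.divisionField 5) σa *
        (absRestrictNormalHom (W.divisionField 5) σa * absRestrictNormalHom (W.divisionField 5) σa)) ⊔ Subgroup.zpowers (absRestrictNormalHom (W.divisionField 5) σs)))) ∈ v.asIdeal)
    (hhZ : haveI : NumberField ↥(W.divisionField 5) := NumberField.mk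
      ¬ 5 ∣ NumberField.classNumber ↥(fixedField (Subgroup.zpowers (absRestrictNormalHom (W.divisionField 5) σa * absRestrictNormalHom (W.divisionField 5) σa *
        absRestrictNormalHom (W.divisionField 5) σs))))
    (hvZ : haveI : NumberField ↥(W.divisionField 5) := NumberField.mk
      ∃! v : IsDedekindDomain.HeightOneSpectrum (𝓞 ↥(fixedField (Subgroup.zpowers (absRestrictNormalHom (W.divisionField 5) σa * absRestrictNormalHom (W.divisionField 5) σa *
        absRestrictNormalHom (W.divisionField 5) σs)))),
        ((5 : ℕ) : 𝓞 ↥(fixedField (Subgroup.zpowers (absRestrictNormalHom (W.divisionField 5) σa * absRestrictNormalHom (W.divisionField 5) σa *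
        absRestrictNormalHom (W.divisionField 5) σs)))) ∈ v.asIdeal)
    (hhQ : haveI : NumberField ↥(W.divisionField 5) := NumberField.mk
      ¬ 5 ∣ NumberField.classNumber ↥(fixedField (Subgroup.zpowers (absRestrictNormalHom (W.divisionField 5) σa))))
    (hvQ : haveI : NumberField ↥(W.divisionField 5) := NumberField.mk
      ∃! v : IsDedekindDomain.HeightOneSpectrum (𝓞 ↥(fixedField (Subgroup.zpowers (absRestrictNormalHom (W.divisionField 5) σa)))),
        ((5 : ℕ) : 𝓞 ↥(fixedField (Subgroup.zpowers (absRestrictNormalHom (W.divisionField 5) σa)))) ∈ v.asIdeal)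
    (hhR : haveI : NumberField ↥(W.divisionField 5) := NumberField.mk
      ¬ 5 ∣ NumberField.classNumber ↥(fixedField (Subgroup.zpowers (absRestrictNormalHom (W.divisionField 5) σa * absRestrictNormalHom (W.divisionField 5) σa) ⊔
        Subgroup.zpowers (absRestrictNormalHom (W.divisionField 5) σa * absRestrictNormalHom (W.divisionField 5) σs))))
    (hvR : haveI : NumberField ↥(W.divisionField 5) := NumberField.mk
      ∃! v : IsDedekindDomain.HeightOneSpectrum (𝓞 ↥(fixedField (Subgroup.zpowers (absRestrictNormalHom (W.divisionField 5) σa * absRestrictNormalHom (W.divisionField 5) σa) ⊔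
        Subgroup.zpowers (absRestrictNormalHom (W.divisionField 5) σa * absRestrictNormalHom (W.divisionField 5) σs)))),
        ((5 : ℕ) : 𝓞 ↥(fixedField (Subgroup.zpowers (absRestrictNormalHom (W.divisionField 5) σa * absRestrictNormalHom (W.divisionField 5) σa) ⊔
        Subgroup.zpowers (absRestrictNormalHom (W.divisionField 5) σa * absRestrictNormalHom (W.divisionField 5) σs)))) ∈ v.asIdeal)
    (κ : ZpExtension ℚ 5) (hκ : κ.IsCyclotomic) :
    ∃ (γ : absoluteGaloisGroup ℚ) (Df : W.FineSelmerDualData κ γ),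
      Module.Finite ℤ_[5] (RestrictScalars ℤ_[5] (IwasawaAlgebra 5) Df.X) := by
  subst hWeq
  haveI : Fact (Nat.Prime 5) := ⟨by norm_num⟩
  exact CartanMuRoadSplitFiveIndexTwoAbelDoors.conjA_five_of_splitCartanIndexTwoBasis_of_classData _ e he σs σa hσs hσa
    hhP hvP hhK hvK hhZ hvZ hhQ hvQ hhR hvR κ hκ

/-- **RE-RECORD — UPPER half `ord₅ #Ш(E) ≤ ord₅ #Ш(E)_an` for `E = 446400hu1` at `p = 5` BY THE μ-ROAD, modulo `hKatoA hGZK hmod` ONLY** (U₀-ns row of KT items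
19202 / 19982): door `CartanMuRoadSplitFiveIndexTwoAbelDoors.missingUpperBoundAt_five_tame_of_splitCartanIndexTwoBasis_of_classData`. KERNEL (g18's file): `Δ ≠ 0`,
global minimality, `E[5]` irreducible, `Addv E 5`, `SubTprime E 5`. DISPLAYED: `hKatoA hGZK hmod`; Cremona's `r_an = 0` (`hr`); the basis data and the class data of
`conjA_g446400hu1_5_abel`. Compared with g18's `missingUpperBoundAt_g446400hu1_5`: `hCS` and `hFW` are GONE. Per row; CONDITIONAL; nothing booked; BSD is not proved by this.
[cite: Kato2004Asterisque, Thm. 14.5 (3) (p. 236), Thm. 12.5 (3) (p. 222)] [cite: CoatesSujatha2005, Thm. 3.4 (§3)] [cite: Miller2011LMS, Def. 1.1]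
[cite: Cremona2006, Table 1 (Cremona label 446400hu1)] -/
theorem missingUpperBoundAt_g446400hu1_5_abel
    (hKatoA : Kato2004.rankZero_padicValNat_sha_add_padicValNat_tamagawa_le_of_additive_potGood_of_irreducible_of_fineSelmerDual_fg)
    (hGZK : rank_eq_analyticRank_of_analyticRank_le_one) (hmod : hasEntireLFunction_rat)
    {W : WeierstrassCurve ℚ} [W.IsElliptic] [W.IsGloballyMinimal] (hWeq : W = (⟨0, 0, 0, (-2565000), 1570826250⟩ : WeierstrassCurve ℚ)) (hr : W.analyticRank = 0)
    (e : W.geomTorsion (5 : ℕ) ≃+ (Fin 2 → ZMod 5))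
    (he : ∀ σ : absoluteGaloisGroup ℚ, ∃ M ∈ splitCartanNormalizer 5, (M 1 1 = M 0 0 ∨ M 1 1 = 4 * M 0 0) ∧
      (M 1 0 = 2 * M 0 1 ∨ M 1 0 = 3 * M 0 1) ∧ ∀ P : W.geomTorsion (5 : ℕ), e (σ • P) = M *ᵥ e P)
    (σs σa : absoluteGaloisGroup ℚ) (hσs : ∀ P : W.geomTorsion (5 : ℕ), e (σs • P) = !![1, 0; 0, 4] *ᵥ e P)
    (hσa : ∀ P : W.geomTorsion (5 : ℕ), e (σa • P) = !![0, 1; 2, 0] *ᵥ e P)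
    (hhP : haveI : NumberField ↥(W.divisionField 5) := NumberField.mk
      ¬ 5 ∣ NumberField.classNumber ↥(fixedField (Subgroup.zpowers (absRestrictNormalHom (W.divisionField 5) σs))))
    (hvP : haveI : NumberField ↥(W.divisionField 5) := NumberField.mk
      ∃! v : IsDedekindDomain.HeightOneSpectrum (𝓞 ↥(fixedField (Subgroup.zpowers (absRestrictNormalHom (W.divisionField 5) σs)))),
        ((5 : ℕ) : 𝓞 ↥(fixedField (Subgroup.zpowers (absRestrictNormalHom (W.divisionField 5) σs)))) ∈ v.asIdeal)
    (hhK : haveI : NumberField ↥(W.divisionField 5) := NumberField.mk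
      ¬ 5 ∣ NumberField.classNumber ↥(fixedField (Subgroup.zpowers (absRestrictNormalHom (W.divisionField 5) σa * absRestrictNormalHom (W.divisionField 5) σa *
        (absRestrictNormalHom (W.divisionField 5) σa * absRestrictNormalHom (W.divisionField 5) σa)) ⊔ Subgroup.zpowers (absRestrictNormalHom (W.divisionField 5) σs))))
    (hvK : haveI : NumberField ↥(W.divisionField 5) := NumberField.mk
      ∃! v : IsDedekindDomain.HeightOneSpectrum (𝓞 ↥(fixedField (Subgroup.zpowers (absRestrictNormalHom (W.divisionField 5) σa * absRestrictNormalHom (W.divisionField 5) σa *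
        (absRestrictNormalHom (W.divisionField 5) σa * absRestrictNormalHom (W.divisionField 5) σa)) ⊔ Subgroup.zpowers (absRestrictNormalHom (W.divisionField 5) σs)))),
        ((5 : ℕ) : 𝓞 ↥(fixedField (Subgroup.zpowers (absRestrictNormalHom (W.divisionField 5) σa * absRestrictNormalHom (W.divisionField 5) σa *
        (absRestrictNormalHom (W.divisionField 5) σa * absRestrictNormalHom (W.divisionField 5) σa)) ⊔ Subgroup.zpowers (absRestrictNormalHom (W.divisionField 5) σs)))) ∈ v.asIdeal)
    (hhZ : haveI : NumberField ↥(W.divisionField 5) := NumberField.mk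
      ¬ 5 ∣ NumberField.classNumber ↥(fixedField (Subgroup.zpowers (absRestrictNormalHom (W.divisionField 5) σa * absRestrictNormalHom (W.divisionField 5) σa *
        absRestrictNormalHom (W.divisionField 5) σs))))
    (hvZ : haveI : NumberField ↥(W.divisionField 5) := NumberField.mk
      ∃! v : IsDedekindDomain.HeightOneSpectrum (𝓞 ↥(fixedField (Subgroup.zpowers (absRestrictNormalHom (W.divisionField 5) σa * absRestrictNormalHom (W.divisionField 5) σa *
        absRestrictNormalHom (W.divisionField 5) σs)))),
        ((5 : ℕ) : 𝓞 ↥(fixedField (Subgroup.zpowers (absRestrictNormalHom (W.divisionField 5) σa * absRestrictNormalHom (W.divisionField 5) σa *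
        absRestrictNormalHom (W.divisionField 5) σs)))) ∈ v.asIdeal)
    (hhQ : haveI : NumberField ↥(W.divisionField 5) := NumberField.mk
      ¬ 5 ∣ NumberField.classNumber ↥(fixedField (Subgroup.zpowers (absRestrictNormalHom (W.divisionField 5) σa))))
    (hvQ : haveI : NumberField ↥(W.divisionField 5) := NumberField.mk
      ∃! v : IsDedekindDomain.HeightOneSpectrum (𝓞 ↥(fixedField (Subgroup.zpowers (absRestrictNormalHom (W.divisionField 5) σa)))),
        ((5 : ℕ) : 𝓞 ↥(fixedField (Subgroup.zpowers (absRestrictNormalHom (W.divisionField 5) σa)))) ∈ v.asIdeal)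
    (hhR : haveI : NumberField ↥(W.divisionField 5) := NumberField.mk
      ¬ 5 ∣ NumberField.classNumber ↥(fixedField (Subgroup.zpowers (absRestrictNormalHom (W.divisionField 5) σa * absRestrictNormalHom (W.divisionField 5) σa) ⊔
        Subgroup.zpowers (absRestrictNormalHom (W.divisionField 5) σa * absRestrictNormalHom (W.divisionField 5) σs))))
    (hvR : haveI : NumberField ↥(W.divisionField 5) := NumberField.mk
      ∃! v : IsDedekindDomain.HeightOneSpectrum (𝓞 ↥(fixedField (Subgroup.zpowers (absRestrictNormalHom (W.divisionField 5) σa * absRestrictNormalHom (W.divisionField 5) σa) ⊔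
        Subgroup.zpowers (absRestrictNormalHom (W.divisionField 5) σa * absRestrictNormalHom (W.divisionField 5) σs)))),
        ((5 : ℕ) : 𝓞 ↥(fixedField (Subgroup.zpowers (absRestrictNormalHom (W.divisionField 5) σa * absRestrictNormalHom (W.divisionField 5) σa) ⊔
        Subgroup.zpowers (absRestrictNormalHom (W.divisionField 5) σa * absRestrictNormalHom (W.divisionField 5) σs)))) ∈ v.asIdeal) :
    MissingUpperBoundAt W 5 := by
  subst hWeq
  haveI : Fact (Nat.Prime 5) := ⟨by norm_num⟩
  exact CartanMuRoadSplitFiveIndexTwoAbelDoors.missingUpperBoundAt_five_tame_of_splitCartanIndexTwoBasis_of_classData _ hKatoA hGZK hmod hr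
    addv_g446400hu1_5 subTprime_g446400hu1_5 irr_g446400hu1_5 e he σs σa hσs hσa hhP hvP hhK hvK hhZ hvZ hhQ hvQ hhR hvR

end Summit.BirchSwinnertonDyer.BirchSwinnertonDyer.Theorems.TameConjAFiveRecords

end
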